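import Summits.HodgeConjecture.HodgeCM.Model.ArchLineDatumOf_1

/-! PORT of `HodgeCM/Model/ArchLineDatumOf.lean` (HodgeCMPerL run 82) — part 2: continuation of `Summits.HodgeConjecture.HodgeCM.Model.ArchLineDatumOf_1` (split at a top-level declaration boundary by port_pkg.py; scope re-opened below; declarations unchanged). -/

-- port_pkg: scope re-opened for this part (file-level context, then the namespace/section stack open at the cut)
set_option autoImplicit false
noncomputable section
open NumberField NumberField.InfinitePlace NumberField.mixedEmbedding IsDedekindDomain
open scoped Matrix Kronecker Classical TensorProduct ComplexConjugate SchwartzMap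
open MvPolynomial
open Literature.NumberTheory.Automorphic Literature.NumberTheory.Automorphic.UnitaryGroup Literature.NumberTheory.Weil1964
open Literature.RepresentationTheory.HeisenbergGroup (polar symplecticGroup)
open Literature.RepresentationTheory.KonnoKonno2007 Literature.RepresentationTheory.KonnoKonno2007.RealDualPair
open Literature.NumberTheory.GelbartRogawski1991 Literature.NumberTheory.GelbartRogawski1991.UnitaryDualPair
open Literature.RepresentationTheory (atPlace)
open Literature.Analysis.SegalBargmann
open HodgeCM.Adelic HodgeCM.PerL34 HodgeCM.Model.HypCensus HodgeCM.Model.SupplyInstance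
namespace HodgeCM.Model.ArchSideTerm
section LinePoly
variable (S' : Type) [Fintype S'] [DecidableEq S']
variable (L : Type) [Field L] [NumberField L] [IsCMField L] {N M n : ℕ} (e : Fin N × Fin M ≃ Fin n)
variable (dV : Fin N → L) (hdV : ∀ i, IsCMField.complexConj L (dV i) = dV i) (hdV0 : ∀ i, dV i ≠ 0)
variable (dW : Fin M → L) (hdW : ∀ i, IsCMField.complexConj L (dW i) = dW i) (hdW0 : ∀ i, dW i ≠ 0)
variable (hGR : (cmSplittingDatum L e dV hdV hdV0 dW hdW hdW0).CompatibleSplitting) (ι₁ : L →+* ℂ)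
variable (eP : PosIdx (cmXV L dV hdV ι₁ (HypCensus.cmPlace L ι₁)) ≃ Fin 2) (eQ : NegIdx (cmXV L dV hdV ι₁ (HypCensus.cmPlace L ι₁)) ≃ Unit)
  (eR : PosIdx (cmXW L dV dW hdW ι₁ (HypCensus.cmPlace L ι₁)) ≃ Unit) (eS : NegIdx (cmXW L dV dW hdW ι₁ (HypCensus.cmPlace L ι₁)) ≃ S')
/-- **THE SLOT SPELLING UNFOLDED**: carch-1's literal family at the covector `⟨b, ·⟩`, tensored with the vacuum elsewhere and pulled back through
binder-2's block frame at `v₁`, IS the Folland–Fock vector of the line's place polynomial in the big frame.  [Folland1989, §1.7, Prop. (4.39)] -/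
theorem blockFamilyOfAt_degOnePDual_binvPi_one (b : Fin 2 → ℂ) :
    blockFamilyOfAt L e dV hdV hdV0 dW hdW hdW0 ι₁ eP eQ eR eS (degOnePDual S') (binvPi 1) (dotProductEquiv ℂ (Fin 2) b) =
      follandFock (cmBigFrame L e dV hdV hdV0 dW hdW hdW0 ι₁) (∏ w, rename (atPlace w) (linePlacePoly S' L e dV hdV dW hdW ι₁ eP eQ eR eS b w)) := by
  have h1 : rename (cmPlaceIdxAt L e dV hdV dW hdW ι₁ (HypCensus.cmPlace L ι₁) eP eQ eR eS)
      (linePlacePoly S' L e dV hdV dW hdW ι₁ eP eQ eR eS b (HypCensus.cmPlace L ι₁)) = degOnePoly S' b := by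
    rw [linePlacePoly_same, rename_rename, Equiv.self_comp_symm, rename_id, AlgHom.id_apply]
  have h2 : (∏ w' : {w : {w : InfinitePlace ↥(maximalRealSubfield L) // w.IsReal} // w ≠ HypCensus.cmPlace L ι₁},
      rename (atPlace w') (linePlacePoly S' L e dV hdV dW hdW ι₁ eP eQ eR eS b w'.1)) = 1 :=
    Finset.prod_eq_one fun w' _ => by rw [linePlacePoly_of_ne S' L e dV hdV dW hdW ι₁ eP eQ eR eS b w'.2, map_one]
  rw [follandFock_prod_atPlace_eq_symm_tensorPi L e dV hdV hdV0 dW hdW hdW0 ι₁ (HypCensus.cmPlace L ι₁) eP eQ eR eS, h1, h2, blockFamilyOfAt_apply,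
    sumProdLeftCLM_apply_eq_tensorPi, degOnePDual_apply, degOneP_eq_binvPi_degOnePoly]

/-- … and it is NONZERO at `b = e₀`. -/
theorem blockFamilyOfAt_degOnePDual_binvPi_one_ne_zero :
    blockFamilyOfAt L e dV hdV hdV0 dW hdW hdW0 ι₁ eP eQ eR eS (degOnePDual S') (binvPi 1)
        (dotProductEquiv ℂ (Fin 2) (Pi.single 0 1)) ≠ 0 := by
  rw [blockFamilyOfAt_apply, sumProdLeftCLM_apply_eq_tensorPi, degOnePDual_apply]
  intro h
  have h' := (cmBlockFrameAt L e dV hdV hdV0 dW hdW hdW0 ι₁ (HypCensus.cmPlace L ι₁) eP eQ eR eS).symm.injective (h.trans (map_zero _).symm)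
  exact tensorPi_ne_zero (degOneP_single_ne_zero S') binvPi_one_ne_zero h'

end LinePoly

/-! ## § 4 The centre on the line's Folland–Fock vector: eigenvalue `χ(t) · ι_{w(v₁)}(t)` -/

section CenterEigen

variable (S' : Type) [Fintype S'] [DecidableEq S']
variable (L : Type) [Field L] [NumberField L] [IsCMField L] {N M n : ℕ} (e : Fin N × Fin M ≃ Fin n)
variable (dV : Fin N → L) (hdV : ∀ i, IsCMField.complexConj L (dV i) = dV i) (hdV0 : ∀ i, dV i ≠ 0)
variable (dW : Fin M → L) (hdW : ∀ i, IsCMField.complexConj L (dW i) = dW i) (hdW0 : ∀ i, dW i ≠ 0)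
variable (hGR : (cmSplittingDatum L e dV hdV hdV0 dW hdW hdW0).CompatibleSplitting) (ι₁ : L →+* ℂ)
variable (eP : PosIdx (cmXV L dV hdV ι₁ (HypCensus.cmPlace L ι₁)) ≃ Fin 2) (eQ : NegIdx (cmXV L dV hdV ι₁ (HypCensus.cmPlace L ι₁)) ≃ Unit)
  (eR : PosIdx (cmXW L dV dW hdW ι₁ (HypCensus.cmPlace L ι₁)) ≃ Unit) (eS : NegIdx (cmXW L dV dW hdW ι₁ (HypCensus.cmPlace L ι₁)) ≃ S')

/-- the diagonal of the centre's letter block at the place `v` in the pin's coordinates: `i ↦ dpTorus (c|_P, c|_Q, 1, 1) (pairFrame_v i)`. -/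
def centerLetterDiag (v : {v : InfinitePlace ↥(maximalRealSubfield L) // v.IsReal})
    (t : ↥(Literature.NumberTheory.Automorphic.relNormOneInfUnits (↥(maximalRealSubfield L)) L)) : Fin n → ℂ := fun i =>
  ((dpTorus (circleRestrict (fun i => 0 < cmXV L dV hdV ι₁ v i) (centerPlaceCircles L v t))
      (circleRestrict (fun i => ¬0 < cmXV L dV hdV ι₁ v i) (centerPlaceCircles L v t))
      (1 : PosIdx (cmXW L dV dW hdW ι₁ v) → Circle) (1 : NegIdx (cmXW L dV dW hdW ι₁ v) → Circle)
      (pairFrame (PosIdx (cmXV L dV hdV ι₁ v)) (NegIdx (cmXV L dV hdV ι₁ v)) (PosIdx (cmXW L dV dW hdW ι₁ v))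
        (NegIdx (cmXW L dV dW hdW ι₁ v)) e (cmEpsV L dV hdV ι₁ v) (cmEpsW L dV dW hdW ι₁ v) i) : Circle) : ℂ)

/-- the centre letter at `v`, read in the pin's coordinates, is the diagonal unitary `diag(centerLetterDiag v t)`. -/
theorem coe_reindexUnitary_dualPairι_centerPlaceLetter (v : {v : InfinitePlace ↥(maximalRealSubfield L) // v.IsReal})
    (t : ↥(Literature.NumberTheory.Automorphic.relNormOneInfUnits (↥(maximalRealSubfield L)) L)) :
    ((reindexUnitary (pairFrame (PosIdx (cmXV L dV hdV ι₁ v)) (NegIdx (cmXV L dV hdV ι₁ v)) (PosIdx (cmXW L dV dW hdW ι₁ v))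
        (NegIdx (cmXW L dV dW hdW ι₁ v)) e (cmEpsV L dV hdV ι₁ v) (cmEpsW L dV dW hdW ι₁ v))
        (dualPairι (centerPlaceLetter L dV hdV dW hdW ι₁ v t)) : Matrix.unitaryGroup (Fin n) ℂ) : Matrix (Fin n) (Fin n) ℂ) =
      Matrix.diagonal (centerLetterDiag L e dV hdV dW hdW ι₁ v t) := by
  have hk : centerPlaceLetter L dV hdV dW hdW ι₁ v t =
      ((diagHom (circleRestrict (fun i => 0 < cmXV L dV hdV ι₁ v i) (centerPlaceCircles L v t)),
        diagHom (circleRestrict (fun i => ¬0 < cmXV L dV hdV ι₁ v i) (centerPlaceCircles L v t))),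
        (diagHom (1 : PosIdx (cmXW L dV dW hdW ι₁ v) → Circle), diagHom (1 : NegIdx (cmXW L dV dW hdW ι₁ v) → Circle))) := by
    rw [map_one, map_one]; rfl
  rw [hk, dualPairι_diagHom]
  ext i j
  simp only [reindexUnitary_apply, coe_diagHom', Matrix.diagonal_apply, EmbeddingLike.apply_eq_iff_eq, centerLetterDiag]

omit [Fintype S'] [DecidableEq S'] in
/-- on the `V⁺ ⊗ W⁺` block at `v₁` the conjugate diagonal entry is the place character `ι_{w(v₁)}(t)`. -/
theorem star_centerLetterDiag_symm_inl_inl (t : ↥(Literature.NumberTheory.Automorphic.relNormOneInfUnits (↥(maximalRealSubfield L)) L)) (pr : Fin 2 × Unit) :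
    star (centerLetterDiag L e dV hdV dW hdW ι₁ (HypCensus.cmPlace L ι₁) t
        ((cmPlaceIdxAt L e dV hdV dW hdW ι₁ (HypCensus.cmPlace L ι₁) eP eQ eR eS).symm (Sum.inl (Sum.inl pr)))) =
      ((NumberField.archPlaceChar L (cmPlaceOver L (HypCensus.cmPlace L ι₁)).1 t : Circle) : ℂ) := by
  simp only [centerLetterDiag, cmPlaceIdxAt, Equiv.symm_trans_apply, Equiv.apply_symm_apply, dpIdxCongr, Equiv.sumCongr_symm,
    Equiv.sumCongr_apply, Sum.map_inl, Equiv.prodCongr_symm, Equiv.prodCongr_apply, dpTorus, Sum.elim_inl,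
    circleRestrict_apply, centerPlaceCircles_apply, Pi.one_apply, mul_one, Circle.coe_inv_eq_conj, Complex.star_def,
    Complex.conj_conj]

/-- the centre's letter block, unfolded (definitional). -/
theorem cmLetterBlock_centerPlaceLetter_apply (t : ↥(Literature.NumberTheory.Automorphic.relNormOneInfUnits (↥(maximalRealSubfield L)) L)) :
    cmLetterBlock L e dV hdV dW hdW ι₁ (centerPlaceLetter L dV hdV dW hdW ι₁) t =
      placeBlock fun v => reindexUnitary
        (pairFrame (PosIdx (cmXV L dV hdV ι₁ v)) (NegIdx (cmXV L dV hdV ι₁ v)) (PosIdx (cmXW L dV dW hdW ι₁ v))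
          (NegIdx (cmXW L dV dW hdW ι₁ v)) e (cmEpsV L dV hdV ι₁ v) (cmEpsW L dV dW hdW ι₁ v))
        (dualPairι (centerPlaceLetter L dV hdV dW hdW ι₁ v t)) := rfl

omit [DecidableEq S'] in
/-- **the letter block of the centre scales the line's place product by `ι_{w(v₁)}(t)`**. -/
theorem linSubst_centerLetterBlock_prod_linePlacePoly (t : ↥(Literature.NumberTheory.Automorphic.relNormOneInfUnits (↥(maximalRealSubfield L)) L)) (b : Fin 2 → ℂ) :
    linSubst (star ((cmLetterBlock L e dV hdV dW hdW ι₁ (centerPlaceLetter L dV hdV dW hdW ι₁) t :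
        Matrix.unitaryGroup (Fin n × {v : InfinitePlace ↥(maximalRealSubfield L) // v.IsReal}) ℂ) : Matrix _ _ ℂ))
        (∏ w, rename (atPlace w) (linePlacePoly S' L e dV hdV dW hdW ι₁ eP eQ eR eS b w)) =
      ((NumberField.archPlaceChar L (cmPlaceOver L (HypCensus.cmPlace L ι₁)).1 t : Circle) : ℂ) •
        ∏ w, rename (atPlace w) (linePlacePoly S' L e dV hdV dW hdW ι₁ eP eQ eR eS b w) := by
  rw [prod_linePlacePoly, cmLetterBlock_centerPlaceLetter_apply, linSubst_star_placeBlock_rename_atPlace,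
    coe_reindexUnitary_dualPairι_centerPlaceLetter,
    linSubst_star_diagonal_rename_degOnePoly S' _ _ _ (star_centerLetterDiag_symm_inl_inl S' L e dV hdV dW hdW ι₁ eP eQ eR eS t),
    map_smul]

omit [DecidableEq S'] in
/-- **THE CENTRE ON THE LINE'S VECTOR**: with `χ` the character of `exists_character_cmArchWeilRep_center`,
`ω_∞(t·1_V, 1) (follandFock 𝔢 (∏_w P_w)) = (χ t · ι_{w(v₁)}(t)) • follandFock 𝔢 (∏_w P_w)`. -/
theorem cmArchWeilRep_center_follandFock_linePlacePoly (χ : ↥(Literature.NumberTheory.Automorphic.relNormOneInfUnits (↥(maximalRealSubfield L)) L) →* Circle)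
    (hχ : ∀ (t : ↥(Literature.NumberTheory.Automorphic.relNormOneInfUnits (↥(maximalRealSubfield L)) L))
        (G : MvPolynomial (Fin n × {v : InfinitePlace ↥(maximalRealSubfield L) // v.IsReal}) ℂ),
        cmArchWeilRep L e dV hdV hdV0 dW hdW hdW0 hGR (cmArchCenter L N (Matrix.diagonal dV) t, 1)
            (follandFock (cmBigFrame L e dV hdV hdV0 dW hdW hdW0 ι₁) G) =
          ((χ t : Circle) : ℂ) •
            follandFock (cmBigFrame L e dV hdV hdV0 dW hdW hdW0 ι₁)
              (linSubst (star ((cmLetterBlock L e dV hdV dW hdW ι₁ (centerPlaceLetter L dV hdV dW hdW ι₁) t :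
                Matrix.unitaryGroup (Fin n × {v : InfinitePlace ↥(maximalRealSubfield L) // v.IsReal}) ℂ) :
                  Matrix _ _ ℂ)) G))
    (t : ↥(Literature.NumberTheory.Automorphic.relNormOneInfUnits (↥(maximalRealSubfield L)) L)) (b : Fin 2 → ℂ) :
    cmArchWeilRep L e dV hdV hdV0 dW hdW hdW0 hGR (cmArchCenter L N (Matrix.diagonal dV) t, 1)
        (follandFock (cmBigFrame L e dV hdV hdV0 dW hdW hdW0 ι₁) (∏ w, rename (atPlace w) (linePlacePoly S' L e dV hdV dW hdW ι₁ eP eQ eR eS b w))) =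
      (((χ t : Circle) : ℂ) * ((NumberField.archPlaceChar L (cmPlaceOver L (HypCensus.cmPlace L ι₁)).1 t : Circle) : ℂ)) •
        follandFock (cmBigFrame L e dV hdV hdV0 dW hdW hdW0 ι₁) (∏ w, rename (atPlace w) (linePlacePoly S' L e dV hdV dW hdW ι₁ eP eQ eR eS b w)) := by
  rw [hχ, linSubst_centerLetterBlock_prod_linePlacePoly, follandFock_smul, smul_smul]

end CenterEigen

/-! ## § 5 The S pin: one line `⟨d⟩` against `V = diag(frameD V)` -/

section OneLine

variable {L : CMField} {ι₁ : L →+* ℂ} (V : HermSpace3 L ι₁)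
variable (d : (L : Type)) (hd : IsCMField.complexConj L d = d) (hd0 : d ≠ 0)
  (hGRd : (cmSplittingDatum (L : Type) (e₁) (frameD V) (frameD_real V) (frameD_ne V) (lineVec (L : Type) d) (fun _ => hd)
    (fun _ => hd0)).CompatibleSplitting)
  (hpos : 0 < cmXW (L : Type) (frameD V) (lineVec (L : Type) d) (fun _ => hd) ι₁ (HypCensus.cmPlace (L : Type) ι₁) 0)

/-- **`Φ_∞` of the line** in carch-1's literal slot spelling: `eR, eS` the blocks of a positive line, `Φ₁ = degOnePDual Empty`, `Φ₂ = B⁻¹ 1`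
(vacuum at the other places), covector `⟨e₀, ·⟩`. -/
def linePhi : 𝓢(((Fin 3) → mixedSpace (↥(maximalRealSubfield L))), ℂ) :=
  blockFamilyOfAt (L : Type) e₁ (frameD V) (frameD_real V) (frameD_ne V) (lineVec (L : Type) d) (fun _ => hd) (fun _ => hd0) ι₁
    (blockPosEquiv V) (blockNegEquiv V) (posIdxEquivUnit hpos) (negIdxEquivEmpty hpos) (degOnePDual Empty) (binvPi 1)
    (dotProductEquiv ℂ (Fin 2) (Pi.single 0 1))

/-- (Ported verbatim from the HodgeCMPerL package; no docstring in the source.) -/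
theorem linePhi_def : linePhi V d hd hd0 hpos =
    blockFamilyOfAt (L : Type) e₁ (frameD V) (frameD_real V) (frameD_ne V) (lineVec (L : Type) d) (fun _ => hd) (fun _ => hd0) ι₁
      (blockPosEquiv V) (blockNegEquiv V) (posIdxEquivUnit hpos) (negIdxEquivEmpty hpos) (degOnePDual Empty) (binvPi 1)
      (dotProductEquiv ℂ (Fin 2) (Pi.single 0 1)) := rfl

/-- `Φ_∞` of the line is the Folland–Fock vector of its place polynomial. -/
theorem linePhi_eq_follandFock : linePhi V d hd hd0 hpos =
    follandFock (cmBigFrame (L : Type) e₁ (frameD V) (frameD_real V) (frameD_ne V) (lineVec (L : Type) d) (fun _ => hd) (fun _ => hd0) ι₁)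
      (∏ w, rename (atPlace w) (linePlacePoly Empty (L : Type) e₁ (frameD V) (frameD_real V) (lineVec (L : Type) d) (fun _ => hd) ι₁
        (blockPosEquiv V) (blockNegEquiv V) (posIdxEquivUnit hpos) (negIdxEquivEmpty hpos) (Pi.single 0 1) w)) :=
  blockFamilyOfAt_degOnePDual_binvPi_one Empty (L : Type) e₁ (frameD V) (frameD_real V) (frameD_ne V) (lineVec (L : Type) d)
    (fun _ => hd) (fun _ => hd0) ι₁ (blockPosEquiv V) (blockNegEquiv V) (posIdxEquivUnit hpos) (negIdxEquivEmpty hpos) (Pi.single 0 1)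

/-- (Ported verbatim from the HodgeCMPerL package; no docstring in the source.) -/
theorem linePhi_ne_zero : linePhi V d hd hd0 hpos ≠ 0 :=
  blockFamilyOfAt_degOnePDual_binvPi_one_ne_zero Empty (L : Type) e₁ (frameD V) (frameD_real V) (frameD_ne V) (lineVec (L : Type) d)
    (fun _ => hd) (fun _ => hd0) ι₁ (blockPosEquiv V) (blockNegEquiv V) (posIdxEquivUnit hpos) (negIdxEquivEmpty hpos)

/-- **`x₀` of the line**: a rational point where `Φ_∞` does not vanish (chosen). -/
def lineX₀ : Fin 3 → ↥(maximalRealSubfield L) :=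
  (exists_apply_archEmb_ne_zero (↥(maximalRealSubfield L)) (Fin 3) (linePhi V d hd hd0 hpos) (linePhi_ne_zero V d hd hd0 hpos)).choose

/-- (Ported verbatim from the HodgeCMPerL package; no docstring in the source.) -/
theorem linePhi_archEmb_lineX₀_ne_zero :
    linePhi V d hd hd0 hpos (archEmb (↥(maximalRealSubfield L)) (Fin 3) (lineX₀ V d hd hd0 hpos)) ≠ 0 :=
  (exists_apply_archEmb_ne_zero (↥(maximalRealSubfield L)) (Fin 3) (linePhi V d hd hd0 hpos) (linePhi_ne_zero V d hd hd0 hpos)).choose_spec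

/-- **the vacuum character `χ` of the centre** for the pair `(V, ⟨d⟩)` (chosen from `exists_character_cmArchWeilRep_center`; the sign facts of
`V` are unitary-1's theorems, those of the line § 0). -/
def lineCenterChar : ↥(Literature.NumberTheory.Automorphic.relNormOneInfUnits (↥(maximalRealSubfield L)) L) →* Circle :=
  (exists_character_cmArchWeilRep_center (L : Type) e₁ (frameD V) (frameD_real V) (frameD_ne V) (lineVec (L : Type) d) (fun _ => hd)
    (fun _ => hd0) hGRd ι₁ (frameD_sign_ι₁' V) (lineVec_sign (L : Type) ι₁ d hd hd0) (frameD_sign_of_ne V)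
    (fun τ hτ => lineVec_sign_of_ne (L : Type) ι₁ d τ hτ)).choose

/-- (Ported verbatim from the HodgeCMPerL package; no docstring in the source.) -/
theorem continuous_lineCenterChar : Continuous (lineCenterChar V d hd hd0 hGRd) :=
  (exists_character_cmArchWeilRep_center (L : Type) e₁ (frameD V) (frameD_real V) (frameD_ne V) (lineVec (L : Type) d) (fun _ => hd)
    (fun _ => hd0) hGRd ι₁ (frameD_sign_ι₁' V) (lineVec_sign (L : Type) ι₁ d hd hd0) (frameD_sign_of_ne V)
    (fun τ hτ => lineVec_sign_of_ne (L : Type) ι₁ d τ hτ)).choose_spec.1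

/-- the defining property of `χ`: `ω_∞(t·1_V, 1) (follandFock 𝔢 G) = χ t • follandFock 𝔢 (G ∘ (centre letter block)⁻¹)`. -/
theorem lineCenterChar_spec (t : ↥(Literature.NumberTheory.Automorphic.relNormOneInfUnits (↥(maximalRealSubfield L)) L))
    (G : MvPolynomial (Fin 3 × {v : InfinitePlace ↥(maximalRealSubfield L) // v.IsReal}) ℂ) :
    cmArchWeilRep (L : Type) e₁ (frameD V) (frameD_real V) (frameD_ne V) (lineVec (L : Type) d) (fun _ => hd) (fun _ => hd0) hGRd
        (cmArchCenter (L : Type) 3 (Matrix.diagonal (frameD V)) t, 1)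
        (follandFock (cmBigFrame (L : Type) e₁ (frameD V) (frameD_real V) (frameD_ne V) (lineVec (L : Type) d) (fun _ => hd) (fun _ => hd0) ι₁) G) =
      ((lineCenterChar V d hd hd0 hGRd t : Circle) : ℂ) •
        follandFock (cmBigFrame (L : Type) e₁ (frameD V) (frameD_real V) (frameD_ne V) (lineVec (L : Type) d) (fun _ => hd) (fun _ => hd0) ι₁)
          (linSubst (star ((cmLetterBlock (L : Type) e₁ (frameD V) (frameD_real V) (lineVec (L : Type) d) (fun _ => hd) ι₁
            (centerPlaceLetter (L : Type) (frameD V) (frameD_real V) (lineVec (L : Type) d) (fun _ => hd) ι₁) t :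
              Matrix.unitaryGroup (Fin 3 × {v : InfinitePlace ↥(maximalRealSubfield L) // v.IsReal}) ℂ) : Matrix _ _ ℂ)) G) :=
  (exists_character_cmArchWeilRep_center (L : Type) e₁ (frameD V) (frameD_real V) (frameD_ne V) (lineVec (L : Type) d) (fun _ => hd)
    (fun _ => hd0) hGRd ι₁ (frameD_sign_ι₁' V) (lineVec_sign (L : Type) ι₁ d hd hd0) (frameD_sign_of_ne V)
    (fun τ hτ => lineVec_sign_of_ne (L : Type) ι₁ d τ hτ)).choose_spec.2 t G

/-- `χ` is PINNED by the vacuum: `ω_∞(t·1_V, 1) (follandFock 𝔢 1) = χ t • follandFock 𝔢 1`. -/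
theorem lineCenterChar_vacuum (t : ↥(Literature.NumberTheory.Automorphic.relNormOneInfUnits (↥(maximalRealSubfield L)) L)) :
    cmArchWeilRep (L : Type) e₁ (frameD V) (frameD_real V) (frameD_ne V) (lineVec (L : Type) d) (fun _ => hd) (fun _ => hd0) hGRd
        (cmArchCenter (L : Type) 3 (Matrix.diagonal (frameD V)) t, 1)
        (follandFock (cmBigFrame (L : Type) e₁ (frameD V) (frameD_real V) (frameD_ne V) (lineVec (L : Type) d) (fun _ => hd) (fun _ => hd0) ι₁) 1) =
      ((lineCenterChar V d hd hd0 hGRd t : Circle) : ℂ) •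
        follandFock (cmBigFrame (L : Type) e₁ (frameD V) (frameD_real V) (frameD_ne V) (lineVec (L : Type) d) (fun _ => hd) (fun _ => hd0) ι₁) 1 := by
  rw [lineCenterChar_spec, map_one]

/-- **the centre eigenvalue of the line**: `c(t) = χ(t) · ι_{w(v₁)}(t)`. -/
def lineC (t : ↥(Literature.NumberTheory.Automorphic.relNormOneInfUnits (↥(maximalRealSubfield L)) L)) : ℂ :=
  ((lineCenterChar V d hd hd0 hGRd t : Circle) : ℂ) * ((NumberField.archPlaceChar L (cmPlaceOver (L : Type) (HypCensus.cmPlace (L : Type) ι₁)).1 t : Circle) : ℂ)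

/-- (Ported verbatim from the HodgeCMPerL package; no docstring in the source.) -/
theorem lineC_def (t : ↥(Literature.NumberTheory.Automorphic.relNormOneInfUnits (↥(maximalRealSubfield L)) L)) : lineC V d hd hd0 hGRd t =
    ((lineCenterChar V d hd hd0 hGRd t : Circle) : ℂ) *
      ((NumberField.archPlaceChar L (cmPlaceOver (L : Type) (HypCensus.cmPlace (L : Type) ι₁)).1 t : Circle) : ℂ) := rfl

/-- **the archimedean centre acts on `Φ_∞` of the line by `c(t)`**. -/
theorem cmArchWeilRep_center_linePhi (t : ↥(Literature.NumberTheory.Automorphic.relNormOneInfUnits (↥(maximalRealSubfield L)) L)) :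
    cmArchWeilRep (L : Type) e₁ (frameD V) (frameD_real V) (frameD_ne V) (lineVec (L : Type) d) (fun _ => hd) (fun _ => hd0) hGRd
        (cmArchCenter (L : Type) 3 (Matrix.diagonal (frameD V)) t, 1) (linePhi V d hd hd0 hpos) =
      lineC V d hd hd0 hGRd t • linePhi V d hd hd0 hpos := by
  rw [linePhi_eq_follandFock]
  exact cmArchWeilRep_center_follandFock_linePlacePoly Empty (L : Type) e₁ (frameD V) (frameD_real V) (frameD_ne V) (lineVec (L : Type) d)
    (fun _ => hd) (fun _ => hd0) hGRd ι₁ (blockPosEquiv V) (blockNegEquiv V) (posIdxEquivUnit hpos) (negIdxEquivEmpty hpos)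
    (lineCenterChar V d hd hd0 hGRd) (lineCenterChar_spec V d hd hd0 hGRd) t (Pi.single 0 1)

/-- **(D5-ctr) OF THE LINE, PROVED**: `ω((t,1)·1_V, 1) φ_N(Φ_∞) = c(t) • φ_N(Φ_∞)` at every base point and level. -/
theorem line_hctr (x₀ : Fin 3 → ↥(maximalRealSubfield L)) (Nl : ℕ) (t : ↥(Literature.NumberTheory.Automorphic.relNormOneInfUnits (↥(maximalRealSubfield L)) L)) :
    cmPairRep (L : Type) e₁ (frameD V) (frameD_real V) (frameD_ne V) (lineVec (L : Type) d) (fun _ => hd) (fun _ => hd0) hGRd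
        (CMCenter (L : Type) (frameD V)
          ((cmAdelicOneEquivRelNormOne (L : Type)).symm (Literature.NumberTheory.Automorphic.relNormOneInfToIdeles (↥(maximalRealSubfield L)) L t)), 1)
        (testFun (↥(maximalRealSubfield L)) (Fin 3) (linePhi V d hd hd0 hpos) x₀ Nl) =
      lineC V d hd hd0 hGRd t • testFun (↥(maximalRealSubfield L)) (Fin 3) (linePhi V d hd hd0 hpos) x₀ Nl := by
  rw [cmPairRep_cmCenter_inf_one_testFun, cmArchWeilRep_center_linePhi, testFun_smul]

end OneLine

/-! ## § 6 The datum -/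

section Datum

variable {L : CMField} {ι₁ : L →+* ℂ} (V : HermSpace3 L ι₁) (S : StubTree.SeesawDatum L)
variable
  (hGR : (cmSplittingDatum (L : Type) finProdFinEquiv (frameD V) (frameD_real V) (frameD_ne V) (dW S) (dW_real S) (dW_ne S)).CompatibleSplitting)
  (hGR₀ : (cmSplittingDatum (L : Type) (e₁) (frameD V) (frameD_real V) (frameD_ne V) (lineVec (L : Type) (dW S 0))
    (fun _ => dW_real S 0) (fun _ => dW_ne S 0)).CompatibleSplitting)
  (hGR₁ : (cmSplittingDatum (L : Type) (e₁) (frameD V) (frameD_real V) (frameD_ne V) (lineVec (L : Type) (dW S 1))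
    (fun _ => dW_real S 1) (fun _ => dW_ne S 1)).CompatibleSplitting)
  (hGR₂ : (cmSplittingDatum (L : Type) (e₁) (frameD V) (frameD_real V) (frameD_ne V) (lineVec (L : Type) (dW' S 0))
    (fun _ => dW'_real S 0) (fun _ => dW'_ne S 0)).CompatibleSplitting)
  (hGR₃ : (cmSplittingDatum (L : Type) (e₁) (frameD V) (frameD_real V) (frameD_ne V) (lineVec (L : Type) (dW' S 1))
    (fun _ => dW'_real S 1) (fun _ => dW'_ne S 1)).CompatibleSplitting)
  (η : CMAdelic (L : Type) (frameD V) × CMAdelic (L : Type) (dW S) →* ℂˣ)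
  (μ : Fin 4 → (InfinitePlace (L : Type) → ℤ))
  (hpos₀ : 0 < cmXW (L : Type) (frameD V) (lineVec (L : Type) (dW S 0)) (fun _ => dW_real S 0) ι₁ (HypCensus.cmPlace (L : Type) ι₁) 0)
  (hpos₁ : 0 < cmXW (L : Type) (frameD V) (lineVec (L : Type) (dW S 1)) (fun _ => dW_real S 1) ι₁ (HypCensus.cmPlace (L : Type) ι₁) 0)
  (hpos₂ : 0 < cmXW (L : Type) (frameD V) (lineVec (L : Type) (dW' S 0)) (fun _ => dW'_real S 0) ι₁ (HypCensus.cmPlace (L : Type) ι₁) 0)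
  (hpos₃ : 0 < cmXW (L : Type) (frameD V) (lineVec (L : Type) (dW' S 1)) (fun _ => dW'_real S 1) ι₁ (HypCensus.cmPlace (L : Type) ι₁) 0)

/-- the four centre eigenvalues. -/
def lineCVec : Fin 4 → (↥(Literature.NumberTheory.Automorphic.relNormOneInfUnits (↥(maximalRealSubfield L)) L) → ℂ) :=
  ![lineC V (dW S 0) (dW_real S 0) (dW_ne S 0) hGR₀, lineC V (dW S 1) (dW_real S 1) (dW_ne S 1) hGR₁,
    lineC V (dW' S 0) (dW'_real S 0) (dW'_ne S 0) hGR₂, lineC V (dW' S 1) (dW'_real S 1) (dW'_ne S 1) hGR₃]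

/-- the four archimedean test functions. -/
def linePhiVec : Fin 4 → 𝓢(((Fin 3) → mixedSpace (↥(maximalRealSubfield L))), ℂ) :=
  ![linePhi V (dW S 0) (dW_real S 0) (dW_ne S 0) hpos₀, linePhi V (dW S 1) (dW_real S 1) (dW_ne S 1) hpos₁,
    linePhi V (dW' S 0) (dW'_real S 0) (dW'_ne S 0) hpos₂, linePhi V (dW' S 1) (dW'_real S 1) (dW'_ne S 1) hpos₃]

/-- the four rational base points. -/
def lineX₀Vec : Fin 4 → (Fin 3 → ↥(maximalRealSubfield L)) :=
  ![lineX₀ V (dW S 0) (dW_real S 0) (dW_ne S 0) hpos₀, lineX₀ V (dW S 1) (dW_real S 1) (dW_ne S 1) hpos₁,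
    lineX₀ V (dW' S 0) (dW'_real S 0) (dW'_ne S 0) hpos₂, lineX₀ V (dW' S 1) (dW'_real S 1) (dW'_ne S 1) hpos₃]

set_option maxHeartbeats 800000 in
/-- **THE ARCHIMEDEAN LINE DATUM OF THE S PIN, CONSTRUCTED.**  Inputs: the pin (`V`, `S`, the GR splittings, `η`, the weights `μ`), the four
positivity CONDITIONS `hposₖ` of the lines at `v₁`, and the four NAMED (J-μ) weight identities about the constructed eigenvalues `lineC`;
everything else — `Φinf`, `x₀`, `hx₀`, `c`, (D5-ctr)₀…₃ — is constructed resp. PROVED above. -/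
def archLineDatumOf
    (hμ₀ : ∀ t : ↥(Literature.NumberTheory.Automorphic.relNormOneInfUnits (↥(maximalRealSubfield L)) L),
      ((eta₀ V S η (1, (cmAdelicOneEquivRelNormOne (L : Type)).symm (Literature.NumberTheory.Automorphic.relNormOneInfToIdeles (↥(maximalRealSubfield L)) L t)) *
              cmLineChar₀ (L : Type) finProdFinEquiv e₁ (frameD V) (frameD_real V) (frameD_ne V) (dW S) (dW_real S) (dW_ne S)
                hGR hGR₀ hGR₁
                (1, CMCenter (L : Type) (lineVec (L : Type) (dW S 0))
                  ((cmAdelicOneEquivRelNormOne (L : Type)).symm (Literature.NumberTheory.Automorphic.relNormOneInfToIdeles (↥(maximalRealSubfield L)) L t))) :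
            ℂˣ) : ℂ) * lineC V (dW S 0) (dW_real S 0) (dW_ne S 0) hGR₀ t =
        Literature.NumberTheory.Automorphic.archWeight (L : Type) (μ 0) t)
    (hμ₁ : ∀ t : ↥(Literature.NumberTheory.Automorphic.relNormOneInfUnits (↥(maximalRealSubfield L)) L),
      ((eta₁ V S η (1, (cmAdelicOneEquivRelNormOne (L : Type)).symm (Literature.NumberTheory.Automorphic.relNormOneInfToIdeles (↥(maximalRealSubfield L)) L t)) *
              cmLineChar₁ (L : Type) finProdFinEquiv e₁ (frameD V) (frameD_real V) (frameD_ne V) (dW S) (dW_real S) (dW_ne S)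
                hGR hGR₀ hGR₁
                (1, CMCenter (L : Type) (lineVec (L : Type) (dW S 1))
                  ((cmAdelicOneEquivRelNormOne (L : Type)).symm (Literature.NumberTheory.Automorphic.relNormOneInfToIdeles (↥(maximalRealSubfield L)) L t))) :
            ℂˣ) : ℂ) * lineC V (dW S 1) (dW_real S 1) (dW_ne S 1) hGR₁ t =
        Literature.NumberTheory.Automorphic.archWeight (L : Type) (μ 1) t)
    (hμ₂ : ∀ t : ↥(Literature.NumberTheory.Automorphic.relNormOneInfUnits (↥(maximalRealSubfield L)) L),
      ((eta₂ V S η (1, (cmAdelicOneEquivRelNormOne (L : Type)).symm (Literature.NumberTheory.Automorphic.relNormOneInfToIdeles (↥(maximalRealSubfield L)) L t)) *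
              cmConjLineChar₀ (L : Type) finProdFinEquiv e₁ (frameD V) (frameD_real V) (frameD_ne V) (dW S) (dW_real S) (dW_ne S)
                (dW' S) (dW'_real S) (dW'_ne S) S.isoGL (isoGL_hg₀ S) hGR hGR₂ hGR₃
                (1, CMCenter (L : Type) (lineVec (L : Type) (dW' S 0))
                  ((cmAdelicOneEquivRelNormOne (L : Type)).symm (Literature.NumberTheory.Automorphic.relNormOneInfToIdeles (↥(maximalRealSubfield L)) L t))) :
            ℂˣ) : ℂ) * lineC V (dW' S 0) (dW'_real S 0) (dW'_ne S 0) hGR₂ t =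
        Literature.NumberTheory.Automorphic.archWeight (L : Type) (μ 2) t)
    (hμ₃ : ∀ t : ↥(Literature.NumberTheory.Automorphic.relNormOneInfUnits (↥(maximalRealSubfield L)) L),
      ((eta₃ V S η (1, (cmAdelicOneEquivRelNormOne (L : Type)).symm (Literature.NumberTheory.Automorphic.relNormOneInfToIdeles (↥(maximalRealSubfield L)) L t)) *
              cmConjLineChar₁ (L : Type) finProdFinEquiv e₁ (frameD V) (frameD_real V) (frameD_ne V) (dW S) (dW_real S) (dW_ne S)
                (dW' S) (dW'_real S) (dW'_ne S) S.isoGL (isoGL_hg₀ S) hGR hGR₂ hGR₃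
                (1, CMCenter (L : Type) (lineVec (L : Type) (dW' S 1))
                  ((cmAdelicOneEquivRelNormOne (L : Type)).symm (Literature.NumberTheory.Automorphic.relNormOneInfToIdeles (↥(maximalRealSubfield L)) L t))) :
            ℂˣ) : ℂ) * lineC V (dW' S 1) (dW'_real S 1) (dW'_ne S 1) hGR₃ t =
        Literature.NumberTheory.Automorphic.archWeight (L : Type) (μ 3) t) :
    ArchLineDatum V S hGR hGR₀ hGR₁ hGR₂ hGR₃ η μ where
  Φinf := linePhiVec V S hpos₀ hpos₁ hpos₂ hpos₃
  x₀ := lineX₀Vec V S hpos₀ hpos₁ hpos₂ hpos₃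
  hx₀ k := by
    fin_cases k
    · exact linePhi_archEmb_lineX₀_ne_zero V (dW S 0) (dW_real S 0) (dW_ne S 0) hpos₀
    · exact linePhi_archEmb_lineX₀_ne_zero V (dW S 1) (dW_real S 1) (dW_ne S 1) hpos₁
    · exact linePhi_archEmb_lineX₀_ne_zero V (dW' S 0) (dW'_real S 0) (dW'_ne S 0) hpos₂
    · exact linePhi_archEmb_lineX₀_ne_zero V (dW' S 1) (dW'_real S 1) (dW'_ne S 1) hpos₃
  c := lineCVec V S hGR₀ hGR₁ hGR₂ hGR₃
  hctr₀ N t := line_hctr V (dW S 0) (dW_real S 0) (dW_ne S 0) hGR₀ hpos₀ _ N t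
  hctr₁ N t := line_hctr V (dW S 1) (dW_real S 1) (dW_ne S 1) hGR₁ hpos₁ _ N t
  hctr₂ N t := line_hctr V (dW' S 0) (dW'_real S 0) (dW'_ne S 0) hGR₂ hpos₂ _ N t
  hctr₃ N t := line_hctr V (dW' S 1) (dW'_real S 1) (dW'_ne S 1) hGR₃ hpos₃ _ N t
  hμ₀ := hμ₀
  hμ₁ := hμ₁
  hμ₂ := hμ₂
  hμ₃ := hμ₃

variable {V S hGR hGR₀ hGR₁ hGR₂ hGR₃ η μ hpos₀ hpos₁ hpos₂ hpos₃}

/-! ### read-off lemmas (all `rfl`) -/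

section ReadOff

variable
  {hμ₀ : ∀ t : ↥(Literature.NumberTheory.Automorphic.relNormOneInfUnits (↥(maximalRealSubfield L)) L),
      ((eta₀ V S η (1, (cmAdelicOneEquivRelNormOne (L : Type)).symm (Literature.NumberTheory.Automorphic.relNormOneInfToIdeles (↥(maximalRealSubfield L)) L t)) *
              cmLineChar₀ (L : Type) finProdFinEquiv e₁ (frameD V) (frameD_real V) (frameD_ne V) (dW S) (dW_real S) (dW_ne S)
                hGR hGR₀ hGR₁
                (1, CMCenter (L : Type) (lineVec (L : Type) (dW S 0))
                  ((cmAdelicOneEquivRelNormOne (L : Type)).symm (Literature.NumberTheory.Automorphic.relNormOneInfToIdeles (↥(maximalRealSubfield L)) L t))) :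
            ℂˣ) : ℂ) * lineC V (dW S 0) (dW_real S 0) (dW_ne S 0) hGR₀ t =
        Literature.NumberTheory.Automorphic.archWeight (L : Type) (μ 0) t}
  {hμ₁ : ∀ t : ↥(Literature.NumberTheory.Automorphic.relNormOneInfUnits (↥(maximalRealSubfield L)) L),
      ((eta₁ V S η (1, (cmAdelicOneEquivRelNormOne (L : Type)).symm (Literature.NumberTheory.Automorphic.relNormOneInfToIdeles (↥(maximalRealSubfield L)) L t)) *
              cmLineChar₁ (L : Type) finProdFinEquiv e₁ (frameD V) (frameD_real V) (frameD_ne V) (dW S) (dW_real S) (dW_ne S)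
                hGR hGR₀ hGR₁
                (1, CMCenter (L : Type) (lineVec (L : Type) (dW S 1))
                  ((cmAdelicOneEquivRelNormOne (L : Type)).symm (Literature.NumberTheory.Automorphic.relNormOneInfToIdeles (↥(maximalRealSubfield L)) L t))) :
            ℂˣ) : ℂ) * lineC V (dW S 1) (dW_real S 1) (dW_ne S 1) hGR₁ t =
        Literature.NumberTheory.Automorphic.archWeight (L : Type) (μ 1) t}
  {hμ₂ : ∀ t : ↥(Literature.NumberTheory.Automorphic.relNormOneInfUnits (↥(maximalRealSubfield L)) L),
      ((eta₂ V S η (1, (cmAdelicOneEquivRelNormOne (L : Type)).symm (Literature.NumberTheory.Automorphic.relNormOneInfToIdeles (↥(maximalRealSubfield L)) L t)) *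
              cmConjLineChar₀ (L : Type) finProdFinEquiv e₁ (frameD V) (frameD_real V) (frameD_ne V) (dW S) (dW_real S) (dW_ne S)
                (dW' S) (dW'_real S) (dW'_ne S) S.isoGL (isoGL_hg₀ S) hGR hGR₂ hGR₃
                (1, CMCenter (L : Type) (lineVec (L : Type) (dW' S 0))
                  ((cmAdelicOneEquivRelNormOne (L : Type)).symm (Literature.NumberTheory.Automorphic.relNormOneInfToIdeles (↥(maximalRealSubfield L)) L t))) :
            ℂˣ) : ℂ) * lineC V (dW' S 0) (dW'_real S 0) (dW'_ne S 0) hGR₂ t =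
        Literature.NumberTheory.Automorphic.archWeight (L : Type) (μ 2) t}
  {hμ₃ : ∀ t : ↥(Literature.NumberTheory.Automorphic.relNormOneInfUnits (↥(maximalRealSubfield L)) L),
      ((eta₃ V S η (1, (cmAdelicOneEquivRelNormOne (L : Type)).symm (Literature.NumberTheory.Automorphic.relNormOneInfToIdeles (↥(maximalRealSubfield L)) L t)) *
              cmConjLineChar₁ (L : Type) finProdFinEquiv e₁ (frameD V) (frameD_real V) (frameD_ne V) (dW S) (dW_real S) (dW_ne S)
                (dW' S) (dW'_real S) (dW'_ne S) S.isoGL (isoGL_hg₀ S) hGR hGR₂ hGR₃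
                (1, CMCenter (L : Type) (lineVec (L : Type) (dW' S 1))
                  ((cmAdelicOneEquivRelNormOne (L : Type)).symm (Literature.NumberTheory.Automorphic.relNormOneInfToIdeles (↥(maximalRealSubfield L)) L t))) :
            ℂˣ) : ℂ) * lineC V (dW' S 1) (dW'_real S 1) (dW'_ne S 1) hGR₃ t =
        Literature.NumberTheory.Automorphic.archWeight (L : Type) (μ 3) t}

/-- (Ported verbatim from the HodgeCMPerL package; no docstring in the source.) -/
theorem archLineDatumOf_Φinf :
    (archLineDatumOf V S hGR hGR₀ hGR₁ hGR₂ hGR₃ η μ hpos₀ hpos₁ hpos₂ hpos₃ hμ₀ hμ₁ hμ₂ hμ₃).Φinf = linePhiVec V S hpos₀ hpos₁ hpos₂ hpos₃ := rfl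


-- port_pkg: scope closed for this part
end ReadOff
end Datum
end HodgeCM.Model.ArchSideTerm
end
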